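import Literature.NumberTheory.EllipticCurves.HuShuYin2019.SylvesterCMPointsConductorNineP
import Literature.NumberTheory.EllipticCurves.HeegnerPointsRationalityProofs
import Literature.NumberTheory.EllipticCurves.JZeroKolyvaginPrimes
import Literature.FieldTheory.AlgClosed.AutFixedSubfield
import HarnessLib

/-!
# DATA LAYER (R-a) of leaf (L1), crux `UpperOffV0HSYPlus` (stmt-BirchSwinnertonDyer-19804): Hu–Shu–Yin's
# CM points of conductor `9pn` are `K[9pn]`-RATIONAL points of `E(K[9pn])` — a THEOREM, for every model
# `W/ℚ` and every modular parametrisation datum `Dt` at level `243`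

Skeleton of record VARIANT M (`Cruxes/UpperOffV0HSYPlus/Lines/coupled_variantM.lean` 406ca288e244d392);
line card v24 `Lines/cmframe-kolyvagin2.md` df2a18c98ac55f71: the rows' residual (R) = the class TERMS of
leaf (L1) via `HuShuYin2019.exists_cmFrame_kolyvaginClass` (R0) fed with the DATA layer — derived CM points
`P_n ∈ E_9(K̄)^N`, their invariance from (ES1), the tower subgroups.  Its FIRST input (k-ty1 SPEC-K-TY v14
§(ES) (E2): «points as DATA with the `map_y` convention: `y : E(K[9p(nℓ)])` with
`hy : map (subtype) y = Dt.φ (heegnerTau Q^{(nℓ)})`») is discharged here: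

* `exists_map_eq_phi_sylvesterTau` — for `K` imaginary quadratic with `d_K = −3`, `ι : K → ℂ`, ANY
  `W/ℚ` with `Dt : ModularParametrizationData W 243`, `p ≡ 1 (mod 3)`, `n ≥ 1` with `3 ∤ n` and
  `gcd(n, C) = 1` (`C = 4p² + 18p + 81`): there is `y ∈ E(K[9pn])` with
  `map (K[9pn] ⊂ ℂ) y = Dt.φ (τ_{Q^{(n)}})`, `Q^{(n)} = (n²A, nB, C)` Hu–Shu–Yin's CM point of conductor
  `9pn` on `X₀(3⁵)` (`A = 81(p² + 4p + 16)`, `B = −9(4p² + 17p + 72)`; HSY p. 10 L92 «`P₁ = [τ, 1]_{U₀(3⁵)}`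
  the CM point on `X₀(3⁵)(H_{9p})`», `f(P₁) = P₀ ∈ E_9(H_{9p})`; Gross 1991 §3 «the point `x_n` is rational
  over `K_n` … `y_n = φ(x_n) ∈ E(K_n)`», here WITHOUT the Heegner hypothesis).
  Proof = the tree's PROVED `ModularParametrizationData.isAutEquivariantOnHeegner` (Darmon Thm. 3.6: `φ`
  is `Aut(ℂ)`-equivariant at level-`243` Heegner forms of discriminant `(9pn)²·(−3)`) + the
  `K[9pn]`-rationality of the moduli point `levelTransport_self_sylvesterPoint_of_fix` + coordinate descent
  (`Complex.mem_subfield_of_forall_ringEquiv`: the fixed field of `Aut(ℂ/K[9pn])` is `K[9pn]`), exactly as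
  `phi_heegnerPointOfConductor_mem_range_map_ringClassField_holds` does under the Heegner hypothesis;
* `map_injective_ringClassField`, `existsUnique_map_eq_phi_sylvesterTau` — the point is unique;
* `exists_map_eq_phi_sylvesterTau_of_primeFactors` — the Kolyvagin-tower form: `n ≠ 0` any product of
  primes `≡ 2 (mod 3)` (then `3 ∤ n` and `gcd(n, C) = 1` by `isCoprime_C_of_forall_prime_mod_three_eq_two`)
  — the binders `hn`, `hn3` of `sum_pointGalHom_eq_lFunction_smul_sylvesterTower` ((ES1), p627619);
* `exists_map_eq_phi_sylvesterTau_one` — the bottom point `y₁ ∈ E(K[9p])` over HSY's `P₁`;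
* `exists_map_eq_phi_sylvesterTau_of_sq_add_self_add_one` (+ `_one_…`) — the same in the ROUTE'S binder
  convention `(K, ω, ω² + ω + 1 = 0, [K:ℚ] = 2)` (`JZero.discr_eq_neg_three_of_sq_add_self_add_one`,
  `JZero.isImaginaryQuadratic_of_sq_add_self_add_one`).

HONEST FRAMING: theorems only (no definition, no named fact, no instance, no notation); a port/assembly of
PROVED tree theorems (Shimura reciprocity for `φ` is `isAutEquivariantOnHeegner`, landed by others); nothing
about Selmer groups, `Ш`, the FLIP, the height display or BSD is asserted; no stub of VARIANT M is closed;
`--supports stmt-BirchSwinnertonDyer-19804 --as helper`.  What it retires: the DATA hypothesis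
`hy`/`hy₀` («`y` over `φ(x(n))`») of every (ES1)/R0 consumer on HSY's tower.

## References
* Y. Hu, J. Shu, H. Yin, *An explicit Gross–Zagier formula related to the Sylvester conjecture*,
  Trans. AMS 372 (2019) 6905–6925; arXiv 1708.05266 §4.1 (p. 10 L59 `f : X₀(3⁵) → E₉`, L92 the point
  `P₁ ∈ X₀(3⁵)(H_{9p})`). [HuShuYin2019]
* B. H. Gross, *Kolyvagin's work on modular elliptic curves*, LMS LNS 153 (1991), §3 p. 238. [GrossLMS1991]
* H. Darmon, *Rational points on modular elliptic curves*, CBMS 101 (2004), Thm. 3.6. [Darmon2004]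

## Mathlib / tree search
Tree: `levelTransport_self_sylvesterPoint_of_fix`, `sylvesterForm_mem_heegnerForms`,
`isCoprime_C_of_forall_prime_mod_three_eq_two` (`HuShuYin2019/SylvesterCMPointsConductorNineP`);
`ModularParametrizationData.isAutEquivariantOnHeegner` (`HeegnerPointsRationalityProofs`);
`apply_sqrtDisc_discr_eq` (`HeegnerPointsShimuraReduction`); `apply_mem_ringClassField`,
`finiteDimensional_and_isGalois_ringClassField` (`HeegnerPointsOfConductor`);
`Complex.mem_subfield_of_forall_ringEquiv` (`FieldTheory/AlgClosed/AutFixedSubfield`);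
`JZero.discr_eq_neg_three_of_sq_add_self_add_one`, `JZero.isImaginaryQuadratic_of_sq_add_self_add_one`
(`JZeroKolyvaginPrimes`).  `lean search 'exists_map_eq_phi_sylvester|sylvesterTau'` → nothing before this file;
the Heegner-hypothesis twin is `phi_heegnerPointOfConductor_mem_range_map_ringClassField_holds`.
presearch: exists_map_eq_phi_sylvesterTau → [corpus:paper:arxiv-1708.05266 p0010 L92] (the statement
«P₁ ∈ X₀(3⁵)(H_{9p})», proof by CM theory = the tree theorems above); galaxy not needed (assembly of tree theorems).
-/

set_option linter.dupNamespace false -- Summits modules are `Summit.<Summit>.<Problem>…` by design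

noncomputable section

open scoped Cardinal

namespace Summit.BirchSwinnertonDyer.BirchSwinnertonDyer.Theorems.SylvesterTwoCMData

open Complex UpperHalfPlane NumberField WeierstrassCurve
open Literature.NumberTheory.EllipticCurves Literature.NumberTheory.EllipticCurves.ModularForms
  Literature.NumberTheory.EllipticCurves.HuShuYin2019
  Literature.NumberTheory.QuadraticFields.BinaryQuadraticForm
  Literature.FieldTheory.AlgClosed

variable {K : Type} [Field K] [NumberField K]

/-- `√(m²D) = m√D` for the normalised square roots `sqrtDisc` (the private helper of
`HeegnerPointsOfConductorRationalityProofs`, re-proved). [folklore] -/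
private theorem sqrtDisc_conductor_sq_mul (D : ℤ) (m : ℕ) :
    sqrtDisc ((m : ℤ) ^ 2 * D) = (m : ℂ) * sqrtDisc D := by
  unfold sqrtDisc
  have hm : (0 : ℝ) ≤ m := Nat.cast_nonneg m
  have h : -(((m : ℤ) ^ 2 * D : ℤ) : ℝ) = (m : ℝ) ^ 2 * (-(D : ℝ)) := by push_cast; ring
  rw [h, Real.sqrt_mul (sq_nonneg _), Real.sqrt_sq hm]
  push_cast
  ring

/-- `K[n]` is countable (`K[n]/K` is finite for `n ≠ 0`; the private helper of
`HeegnerPointsOfConductorRationalityProofs`, re-proved). [folklore] -/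
private theorem cardinalMk_ringClassField_le (hK : IsImaginaryQuadratic K) (ι : K →+* ℂ) {n : ℕ}
    (hn : n ≠ 0) : #(ringClassField K ι n) ≤ ℵ₀ := by
  haveI := (finiteDimensional_and_isGalois_ringClassField hK ι hn).1
  haveI : FiniteDimensional ℚ (ringClassField K ι n) := Module.Finite.trans K (ringClassField K ι n)
  haveI : Algebra.IsAlgebraic ℚ (ringClassField K ι n) := Algebra.IsAlgebraic.of_finite ℚ _
  exact Subfield.cardinalMk_le_aleph0_of_isAlgebraic _

/-- **A complex point of `E` fixed by `Aut(ℂ/F)` is `F`-rational**, for a countable subfield `F ⊆ ℂ`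
(coordinate descent: the fixed field of `Aut(ℂ/F)` is `F`, the tree's
`Complex.mem_subfield_of_forall_ringEquiv`; Silverman AEC VIII §1). [folklore] -/
theorem exists_map_subtype_eq_of_forall_ringEquiv (W : WeierstrassCurve ℚ) (F : Subfield ℂ)
    (hF : #F ≤ ℵ₀) {P : (W.baseChange ℂ).toAffine.Point}
    (hfix : ∀ σ : ℂ ≃+* ℂ, (∀ x ∈ F, σ x = x) →
      Affine.Point.map (W' := W) (σ : ℂ →+* ℂ).toRatAlgHom P = P) :
    ∃ y : (W.baseChange F).toAffine.Point, Affine.Point.map (W' := W) F.subtype.toRatAlgHom y = P := by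
  rcases hP₀ : P with _ | ⟨x, y, hxy⟩
  · exact ⟨0, rfl⟩
  · have hcoord : ∀ σ : ℂ ≃+* ℂ, (∀ z ∈ F, σ z = z) → σ x = x ∧ σ y = y := by
      intro σ hσ
      have h := hfix σ hσ
      rw [hP₀, Affine.Point.map_some] at h
      have h12 := Affine.Point.some.inj h
      exact ⟨h12.1, h12.2⟩
    have hx : x ∈ F := Complex.mem_subfield_of_forall_ringEquiv F hF fun σ hσ ↦ (hcoord σ hσ).1
    have hy : y ∈ F := Complex.mem_subfield_of_forall_ringEquiv F hF fun σ hσ ↦ (hcoord σ hσ).2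
    have h₀ : (W.baseChange F).toAffine.Nonsingular ⟨x, hx⟩ ⟨y, hy⟩ :=
      (Affine.baseChange_nonsingular W (f := F.subtype.toRatAlgHom) F.subtype.injective
        ⟨x, hx⟩ ⟨y, hy⟩).mp hxy
    exact ⟨.some ⟨x, hx⟩ ⟨y, hy⟩ h₀, rfl⟩

/-- **The map `E(K[n]) → E(ℂ)` along `K[n] ⊆ ℂ` is injective** (so the rational point over `φ(x(n))`
is unique). [folklore] -/
theorem map_injective_ringClassField (W : WeierstrassCurve ℚ) (ι : K →+* ℂ) (m : ℕ) :
    Function.Injective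
      (Affine.Point.map (W' := W) (ringClassField K ι m).subtype.toRatAlgHom) :=
  Affine.Point.map_injective (W' := W) _

/-- **`φ(τ_Q) ∈ E(K[f])` for a level-`N` Heegner form `Q` of discriminant `f²·d_K` whose level structure
is fixed by `Aut(ℂ/K[f])`** (the generic step, NO Heegner hypothesis): `φ` is `Aut(ℂ)`-equivariant at
Heegner forms (`isAutEquivariantOnHeegner`, Darmon Thm. 3.6), `σ ∈ Aut(ℂ/K[f])` fixes `√(f²d_K) = f√d_K`,
so `σ` fixes `φ(τ_Q)`; then coordinate descent. [cite: Darmon2004, Thm. 3.6 (PDF p. 43)]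
[cite: GrossLMS1991, §3 (p. 238)] -/
theorem exists_map_eq_phi_of_levelTransport (hK : IsImaginaryQuadratic K) (ι : K →+* ℂ)
    {W : WeierstrassCurve ℚ} {N : ℕ} [NeZero N] (Dt : ModularParametrizationData W N) {f : ℕ}
    (hf : f ≠ 0) {Q : ℤ × ℤ × ℤ} (hQ : Q ∈ heegnerForms N ((f : ℤ) ^ 2 * NumberField.discr K))
    (hLT : ∀ σ : ℂ ≃+* ℂ, (∀ x ∈ ringClassField K ι f, σ x = x) →
      LevelTransport N σ (heegnerTau Q) (heegnerTau Q)) :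
    ∃ y : (W.baseChange (ringClassField K ι f)).toAffine.Point,
      Affine.Point.map (W' := W) (ringClassField K ι f).subtype.toRatAlgHom y = Dt.φ (heegnerTau Q) := by
  set F := ringClassField K ι f with hF_def
  have hφ : Dt.IsAutEquivariantOnHeegner ((f : ℤ) ^ 2 * NumberField.discr K) :=
    Dt.isAutEquivariantOnHeegner _
  -- every `σ ∈ Aut(ℂ/K[f])` fixes `φ(τ_Q)`
  have hfix : ∀ σ : ℂ ≃+* ℂ, (∀ x ∈ F, σ x = x) →
      Affine.Point.map (W' := W) (σ : ℂ →+* ℂ).toRatAlgHom (Dt.φ (heegnerTau Q)) =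
        Dt.φ (heegnerTau Q) := by
    intro σ hσ
    have hσK : ∀ k : K, σ (ι k) = ι k := fun k ↦ hσ _ (apply_mem_ringClassField ι f k)
    have hsqrt : σ (sqrtDisc ((f : ℤ) ^ 2 * NumberField.discr K)) =
        sqrtDisc ((f : ℤ) ^ 2 * NumberField.discr K) := by
      rw [sqrtDisc_conductor_sq_mul, map_mul, map_natCast, apply_sqrtDisc_discr_eq hK ι hσK]
    exact hφ σ hsqrt hQ hQ (hLT σ hσ)
  exact exists_map_subtype_eq_of_forall_ringEquiv W F (cardinalMk_ringClassField_le hK ι hf) hfix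

/-- **Hu–Shu–Yin's CM point of conductor `9pn` is `K[9pn]`-rational on `E` — THEOREM** (Gross 1991 §3
«`y_n = φ(x_n) ∈ E(K_n)`» at HSY's frame `X₀(3⁵) → E`, ring class field of conductor `9pn` of
`K = ℚ(√−3)`, NO Heegner hypothesis): for `K` imaginary quadratic with `d_K = −3`, `ι : K → ℂ`, any
`W/ℚ` with a modular parametrisation datum `Dt` at level `243`, `p ≡ 1 (mod 3)`, `n ≠ 0`, `3 ∤ n`,
`gcd(n, 4p² + 18p + 81) = 1`, there is `y ∈ E(K[9pn])` mapping to `Dt.φ (τ_{(n²A, nB, C)})` under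
`K[9pn] ⊆ ℂ`.  Proof: every `σ ∈ Aut(ℂ/K[9pn])` fixes `√((9pn)²·(−3)) = 9pn·√−3` and the level structure
of `τ` (`levelTransport_self_sylvesterPoint_of_fix`), hence `φ(τ)` (`isAutEquivariantOnHeegner`); then
coordinate descent. [cite: GrossLMS1991, §3 (p. 238: x_n rational over K_n, y_n = φ(x_n) ∈ E(K_n))]
[cite: HuShuYin2019, §4.1 (p. 10 L92: P₁ ∈ X₀(3⁵)(H_{9p}))] [cite: Darmon2004, Thm. 3.6 (PDF p. 43)] -/
theorem exists_map_eq_phi_sylvesterTau (hK : IsImaginaryQuadratic K) (hdK : NumberField.discr K = -3)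
    (ι : K →+* ℂ) {W : WeierstrassCurve ℚ} (Dt : ModularParametrizationData W 243) {p n : ℕ}
    (hp : p % 3 = 1) (hn : n ≠ 0) (hn3 : ¬ 3 ∣ n)
    (hnC : IsCoprime (n : ℤ) (4 * (p : ℤ) ^ 2 + 18 * p + 81)) :
    ∃ y : (W.baseChange (ringClassField K ι (9 * p * n))).toAffine.Point,
      Affine.Point.map (W' := W) (ringClassField K ι (9 * p * n)).subtype.toRatAlgHom y =
        Dt.φ (heegnerTau ((n : ℤ) ^ 2 * (81 * ((p : ℤ) ^ 2 + 4 * p + 16)),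
          (n : ℤ) * (-(9 * (4 * (p : ℤ) ^ 2 + 17 * p + 72))), 4 * (p : ℤ) ^ 2 + 18 * p + 81)) := by
  haveI : NeZero (243 : ℕ) := ⟨by norm_num⟩
  have hp0 : p ≠ 0 := by rintro rfl; simp at hp
  have hf : 9 * p * n ≠ 0 := mul_ne_zero (mul_ne_zero (by norm_num) hp0) hn
  -- the form `(n²A, nB, C)` has discriminant `(9pn)² · d_K`
  have hQ' : ((n : ℤ) ^ 2 * (81 * ((p : ℤ) ^ 2 + 4 * p + 16)),
      (n : ℤ) * (-(9 * (4 * (p : ℤ) ^ 2 + 17 * p + 72))), 4 * (p : ℤ) ^ 2 + 18 * p + 81) ∈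
      heegnerForms 243 (((9 * p * n : ℕ) : ℤ) ^ 2 * NumberField.discr K) := by
    rw [hdK]; exact sylvesterForm_mem_heegnerForms hp hn hnC
  exact exists_map_eq_phi_of_levelTransport hK ι Dt hf hQ'
    fun σ hσ ↦ levelTransport_self_sylvesterPoint_of_fix hK hdK ι hp hn hn3 hnC hσ

/-- **Uniqueness form**: there is EXACTLY ONE `y ∈ E(K[9pn])` over `φ(τ_{Q^{(n)}})`. [cite: GrossLMS1991, §3 (p. 238)] -/
theorem existsUnique_map_eq_phi_sylvesterTau (hK : IsImaginaryQuadratic K)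
    (hdK : NumberField.discr K = -3) (ι : K →+* ℂ) {W : WeierstrassCurve ℚ}
    (Dt : ModularParametrizationData W 243) {p n : ℕ} (hp : p % 3 = 1) (hn : n ≠ 0) (hn3 : ¬ 3 ∣ n)
    (hnC : IsCoprime (n : ℤ) (4 * (p : ℤ) ^ 2 + 18 * p + 81)) :
    ∃! y : (W.baseChange (ringClassField K ι (9 * p * n))).toAffine.Point,
      Affine.Point.map (W' := W) (ringClassField K ι (9 * p * n)).subtype.toRatAlgHom y =
        Dt.φ (heegnerTau ((n : ℤ) ^ 2 * (81 * ((p : ℤ) ^ 2 + 4 * p + 16)),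
          (n : ℤ) * (-(9 * (4 * (p : ℤ) ^ 2 + 17 * p + 72))), 4 * (p : ℤ) ^ 2 + 18 * p + 81)) := by
  obtain ⟨y, hy⟩ := exists_map_eq_phi_sylvesterTau hK hdK ι Dt hp hn hn3 hnC
  exact ⟨y, hy, fun y' hy' ↦ map_injective_ringClassField W ι _ (hy'.trans hy.symm)⟩

/-- **Kolyvagin-tower form**: for `n ≠ 0` a product of primes `≡ 2 (mod 3)` (square-freeness not needed)
the CM point of conductor `9pn` is `K[9pn]`-rational on `E` — the points `y`, `y₀` that (ES1)
`sum_pointGalHom_eq_lFunction_smul_sylvesterTower` takes as data EXIST (`3 ∤ n` and `gcd(n, C) = 1` by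
`isCoprime_C_of_forall_prime_mod_three_eq_two`). [cite: GrossLMS1991, §3 (p. 238)]
[cite: HuShuYin2019, §4.1 (p. 10 L92)] -/
theorem exists_map_eq_phi_sylvesterTau_of_primeFactors (hK : IsImaginaryQuadratic K)
    (hdK : NumberField.discr K = -3) (ι : K →+* ℂ) {W : WeierstrassCurve ℚ}
    (Dt : ModularParametrizationData W 243) {p n : ℕ} (hp : p % 3 = 1) (hn : n ≠ 0)
    (hn3 : ∀ q ∈ n.primeFactors, q % 3 = 2) :
    ∃ y : (W.baseChange (ringClassField K ι (9 * p * n))).toAffine.Point,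
      Affine.Point.map (W' := W) (ringClassField K ι (9 * p * n)).subtype.toRatAlgHom y =
        Dt.φ (heegnerTau ((n : ℤ) ^ 2 * (81 * ((p : ℤ) ^ 2 + 4 * p + 16)),
          (n : ℤ) * (-(9 * (4 * (p : ℤ) ^ 2 + 17 * p + 72))), 4 * (p : ℤ) ^ 2 + 18 * p + 81)) := by
  have h3n : ¬ 3 ∣ n := fun h ↦ by
    have := hn3 3 (Nat.mem_primeFactors.mpr ⟨Nat.prime_three, h, hn⟩)
    omega
  exact exists_map_eq_phi_sylvesterTau hK hdK ι Dt hp hn h3n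
    (isCoprime_C_of_forall_prime_mod_three_eq_two (p := p) hn hn3)

/-- **The bottom point: HSY's `P₀ = f(P₁) ∈ E(K[9p])`** — there is `y₁ ∈ E(K[9p])` over `φ(τ_{Q_p})`,
`Q_p = (81(p²+4p+16), −9(4p²+17p+72), 4p²+18p+81)` (HSY p. 10 L92 «`f(P₁) = P₀`», `P₁ ∈ X₀(3⁵)(H_{9p})`).
[cite: HuShuYin2019, §4.1 (p. 10 L92)] [cite: GrossLMS1991, §3 (p. 238)] -/
theorem exists_map_eq_phi_sylvesterTau_one (hK : IsImaginaryQuadratic K)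
    (hdK : NumberField.discr K = -3) (ι : K →+* ℂ) {W : WeierstrassCurve ℚ}
    (Dt : ModularParametrizationData W 243) {p : ℕ} (hp : p % 3 = 1) :
    ∃ y : (W.baseChange (ringClassField K ι (9 * p))).toAffine.Point,
      Affine.Point.map (W' := W) (ringClassField K ι (9 * p)).subtype.toRatAlgHom y =
        Dt.φ (heegnerTau (81 * ((p : ℤ) ^ 2 + 4 * p + 16), -(9 * (4 * (p : ℤ) ^ 2 + 17 * p + 72)),
          4 * (p : ℤ) ^ 2 + 18 * p + 81)) := by
  haveI : NeZero (243 : ℕ) := ⟨by norm_num⟩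
  have hp0 : p ≠ 0 := by rintro rfl; simp at hp
  have hf : 9 * p ≠ 0 := mul_ne_zero (by norm_num) hp0
  -- the form `Q_p = (A, B, C)` has discriminant `(9p)² · d_K`
  have hQ' : ((81 * ((p : ℤ) ^ 2 + 4 * p + 16)), (-(9 * (4 * (p : ℤ) ^ 2 + 17 * p + 72))),
      4 * (p : ℤ) ^ 2 + 18 * p + 81) ∈ heegnerForms 243 (((9 * p : ℕ) : ℤ) ^ 2 * NumberField.discr K) := by
    have h := sylvesterForm_mem_heegnerForms (n := 1) hp one_ne_zero isCoprime_one_left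
    simp only [Nat.cast_one, one_pow, one_mul, mul_one] at h
    rw [hdK]; exact h
  exact exists_map_eq_phi_of_levelTransport hK ι Dt hf hQ'
    fun σ hσ ↦ levelTransport_self_sylvesterPoint_one_of_fix hK hdK ι hp hσ

/-! ### The route's binder convention `(K, ω, ω² + ω + 1 = 0, [K:ℚ] = 2)` -/

/-- **Rationality of the CM tower in the route's binders**: for a number field `K` with `ω² + ω + 1 = 0`
and `[K:ℚ] = 2` (so `K ≅ ℚ(√−3)`, `d_K = −3`), `ι : K → ℂ`, any `W/ℚ` with `Dt` at level `243`,
`p ≡ 1 (mod 3)` and `n ≠ 0` a product of primes `≡ 2 (mod 3)`: the CM point of conductor `9pn` is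
`K[9pn]`-rational on `E`. [cite: GrossLMS1991, §3 (p. 238)] [cite: HuShuYin2019, §4.1 (p. 10 L92)] -/
theorem exists_map_eq_phi_sylvesterTau_of_sq_add_self_add_one {ω : K} (hω : ω ^ 2 + ω + 1 = 0)
    (h2 : Module.finrank ℚ K = 2) (ι : K →+* ℂ) {W : WeierstrassCurve ℚ}
    (Dt : ModularParametrizationData W 243) {p n : ℕ} (hp : p % 3 = 1) (hn : n ≠ 0)
    (hn3 : ∀ q ∈ n.primeFactors, q % 3 = 2) :
    ∃ y : (W.baseChange (ringClassField K ι (9 * p * n))).toAffine.Point,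
      Affine.Point.map (W' := W) (ringClassField K ι (9 * p * n)).subtype.toRatAlgHom y =
        Dt.φ (heegnerTau ((n : ℤ) ^ 2 * (81 * ((p : ℤ) ^ 2 + 4 * p + 16)),
          (n : ℤ) * (-(9 * (4 * (p : ℤ) ^ 2 + 17 * p + 72))), 4 * (p : ℤ) ^ 2 + 18 * p + 81)) :=
  exists_map_eq_phi_sylvesterTau_of_primeFactors (JZero.isImaginaryQuadratic_of_sq_add_self_add_one hω h2)
    (JZero.discr_eq_neg_three_of_sq_add_self_add_one hω h2) ι Dt hp hn hn3

/-- **The bottom point in the route's binders**: `y₁ ∈ E(K[9p])` over `φ(τ_{Q_p})` for `K ∋ ω` quadratic.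
[cite: HuShuYin2019, §4.1 (p. 10 L92)] -/
theorem exists_map_eq_phi_sylvesterTau_one_of_sq_add_self_add_one {ω : K} (hω : ω ^ 2 + ω + 1 = 0)
    (h2 : Module.finrank ℚ K = 2) (ι : K →+* ℂ) {W : WeierstrassCurve ℚ}
    (Dt : ModularParametrizationData W 243) {p : ℕ} (hp : p % 3 = 1) :
    ∃ y : (W.baseChange (ringClassField K ι (9 * p))).toAffine.Point,
      Affine.Point.map (W' := W) (ringClassField K ι (9 * p)).subtype.toRatAlgHom y =
        Dt.φ (heegnerTau (81 * ((p : ℤ) ^ 2 + 4 * p + 16), -(9 * (4 * (p : ℤ) ^ 2 + 17 * p + 72)),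
          4 * (p : ℤ) ^ 2 + 18 * p + 81)) :=
  exists_map_eq_phi_sylvesterTau_one (JZero.isImaginaryQuadratic_of_sq_add_self_add_one hω h2)
    (JZero.discr_eq_neg_three_of_sq_add_self_add_one hω h2) ι Dt hp

end Summit.BirchSwinnertonDyer.BirchSwinnertonDyer.Theorems.SylvesterTwoCMData

end
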